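import Summits.PneNP.PneNP.Theorems.RamseyNotNP.Negative.Sandwich

/-!
# `RamseyNotNP` (stmt-PneNP-9814) — negative-side lemmas: complement symmetry on codes and the lattice of sufficient targets

Companion of `ThresholdLoadBearing.lean` / `Sandwich.lean` (cdisprove, gen 1) for the crux
`Summit.PneNP.PneNP.Theses.RamseyUncertifiable.RamseyNotNP` (`RAMSEY₂ ∉ NP`):

* §9 COMPLEMENT SYMMETRY: `exists_complFn` — the map `code G ↦ code Gᶜ` is in `FP` (typed `CodeFP` calculus:
  bit access by a binary index, `natDiv`/`natMod`, `map` over `range |bits|`, `bitsToStr`);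
  `cliqueFree_mem_NP_iff` / `cliqueFree_mem_P_iff` (`CLIQUEFREE_k ∈ NP ↔ INDEPFREE_k ∈ NP`, same in `P`),
  hence `cliqueFree_not_mem_NP_of_ramseyNotNPAt`: the crux forces `CLIQUEFREE_{⌈2log₂n⌉} ∉ NP` outright.
* §10 TARGET LATTICE `targetLattice`: `RamseyNotNP ⟹ CLIQUEFREE_thr ∉ NP ⟹ CLIQUEFREE_thr ∉ P`,
  `RamseyNotNP ⟹ RAMSEY₂ ∉ P ⟹ CLIQUEFREE_thr ∉ P`, and the bottom node already closes the summit
  (`cliqueFreeLang_thr_mem_P_of_not_pneNP`, contrapositive form, via `cliqueFreeLang_thr_mem_coNP`: `CLIQUEFREE_thr ∈ coNP` by the tree's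
  `CLIQUE_mem_NP` pulled back along the `FP` threshold pairing `exists_thrPairFn`).  The filed crux is the TOP
  of a lattice of summit-sufficient targets whose bottom is "`ω(G) < ⌈2log₂ n⌉` is not decidable in P"
  (LOGCLIQUE ∉ P, a consequence of ETH): planners may weaken the target two steps (one-sided; `∉ P`) without
  losing the summit — the extra strength buys `coNP ≠ NP` and two-sidedness for the SoS mechanism.
  Read downward: `not_ramseyNotNP_of_cliqueFree_mem_NP` / `not_ramseyNotNP_of_cliqueFree_mem_P` — a one-sided
  certificate scheme, or a polynomial-time LOGCLIQUE algorithm, already refutes the crux.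

Refuter seat cdisprove-stmt-PneNP-9814, 2026-08-16.
-/

-- `Summit.PneNP.PneNP.…` duplicates `PneNP` BY DESIGN (single-problem summit, D-0017).
set_option linter.dupNamespace false

namespace Summit.PneNP.PneNP.Theorems.RamseyNotNP.Negative

open Literature.Computability.Complexity _root_.Computability
open Summit.PneNP.PneNP.Theses.RamseyUncertifiable (RamseyNotNP RamseyInCoNP)

/-! ## §9 Complement symmetry on codes: `CLIQUEFREE_k ∈ NP ↔ INDEPFREE_k ∈ NP`, so the crux forces each -/

/-- Complementation on the fields `(n, bits)` of a graph code: flip every bit off the diagonal, clear the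
diagonal. [folklore] -/
def complBits (q : ℕ × List Bool) : ℕ × List Bool :=
  (q.1, (List.range q.2.length).map fun t => (!q.2.getD t false) && !decide (t / q.1 = t % q.1))

/-- **`complBits` is computed on codes in polynomial time** (typed `CodeFP` calculus: bit access by a
binary index, `natDiv`/`natMod`, a `map` over `range |bits|`, `bitsToStr`). [folklore] -/
theorem complBits_codeFP :
    CodeFP (CodeFP.pairE CodeFP.natE CodeFP.strE) (CodeFP.pairE CodeFP.natE CodeFP.strE) complBits := by
  have hn : CodeFP (CodeFP.pairE CodeFP.natE CodeFP.strE) CodeFP.natE (fun q : ℕ × List Bool => q.1) :=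
    CodeFP.fst _ _
  have hbits : CodeFP (CodeFP.pairE CodeFP.natE CodeFP.strE) CodeFP.strE (fun q : ℕ × List Bool => q.2) :=
    CodeFP.snd _ _
  have hrange : CodeFP (CodeFP.pairE CodeFP.natE CodeFP.strE) (CodeFP.rawE CodeFP.natE)
      (fun q : ℕ × List Bool => List.range q.2.length) :=
    CodeFP.urange.comp (CodeFP.strLength.comp hbits)
  have gn : CodeFP (CodeFP.pairE (CodeFP.pairE CodeFP.natE CodeFP.strE) CodeFP.natE) CodeFP.natE
      (fun r : (ℕ × List Bool) × ℕ => r.1.1) := hn.comp (CodeFP.fst _ _)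
  have gbits : CodeFP (CodeFP.pairE (CodeFP.pairE CodeFP.natE CodeFP.strE) CodeFP.natE) CodeFP.strE
      (fun r : (ℕ × List Bool) × ℕ => r.1.2) := hbits.comp (CodeFP.fst _ _)
  have gt : CodeFP (CodeFP.pairE (CodeFP.pairE CodeFP.natE CodeFP.strE) CodeFP.natE) CodeFP.natE
      (fun r : (ℕ × List Bool) × ℕ => r.2) := CodeFP.snd _ _
  have gb : CodeFP (CodeFP.pairE (CodeFP.pairE CodeFP.natE CodeFP.strE) CodeFP.natE) CodeFP.bitE
      (fun r : (ℕ × List Bool) × ℕ => r.1.2.getD r.2 false) :=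
    CodeFP.strGetDNat.comp (gbits.pair gt)
  have gd : CodeFP (CodeFP.pairE (CodeFP.pairE CodeFP.natE CodeFP.strE) CodeFP.natE) CodeFP.bitE
      (fun r : (ℕ × List Bool) × ℕ => decide (r.2 / r.1.1 = r.2 % r.1.1)) :=
    CodeFP.natEq.comp ((CodeFP.natDiv.comp (gt.pair gn)).pair (CodeFP.natMod.comp (gt.pair gn)))
  have gp : CodeFP (CodeFP.pairE (CodeFP.pairE CodeFP.natE CodeFP.strE) CodeFP.natE) CodeFP.bitE
      (fun r : (ℕ × List Bool) × ℕ => (!r.1.2.getD r.2 false) && !decide (r.2 / r.1.1 = r.2 % r.1.1)) :=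
    gb.not.and gd.not
  have hmap : CodeFP (CodeFP.pairE CodeFP.natE CodeFP.strE) (CodeFP.rawE CodeFP.bitE)
      (fun q : ℕ × List Bool =>
        (List.range q.2.length).map fun t => (!q.2.getD t false) && !decide (t / q.1 = t % q.1)) :=
    (CodeFP.map gp).comp ((CodeFP.id _).pair hrange)
  exact hn.pair (CodeFP.bitsToStr.comp hmap)

/-- `complBits` sends the adjacency bits of `G` to those of `Gᶜ`. [folklore] -/
theorem complBits_adjBits (n : ℕ) (G : SimpleGraph (Fin n)) :
    complBits (n, CliqueNP.adjBits n G) = (n, CliqueNP.adjBits n Gᶜ) := by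
  refine Prod.ext rfl ?_
  simp only [complBits, CliqueNP.length_adjBits]
  refine List.ext_getElem (by simp) fun t h1 h2 => ?_
  have ht : t < n * n := by simpa using h2
  rw [List.getElem_map, List.getElem_range, ← List.getD_eq_getElem _ false h2,
    CliqueNP.getD_adjBits Gᶜ ht, CliqueNP.getD_adjBits G ht]
  rw [Bool.eq_iff_iff]
  simp only [Bool.and_eq_true, Bool.not_eq_true', decide_eq_false_iff_not, decide_eq_true_eq,
    SimpleGraph.compl_adj, ne_eq, Fin.mk.injEq]
  tauto

/-- **The complement map on graph codes is in `FP`**: some `f ∈ FP` has `f (code G) = code Gᶜ`.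
[folklore] -/
theorem exists_complFn : ∃ f ∈ FP, ∀ (n : ℕ) (G : SimpleGraph (Fin n)),
    f (encodingGraph.encode ⟨n, G⟩) = encodingGraph.encode ⟨n, Gᶜ⟩ := by
  obtain ⟨f, hf, hspec⟩ := complBits_codeFP
  refine ⟨f, hf, fun n G => ?_⟩
  have h := hspec (n, CliqueNP.adjBits n G)
  rw [complBits_adjBits] at h
  rw [HamNP.encode_eq, HamNP.encode_eq]
  exact h

/-- `INDEPFREE_k` is the pull-back of `CLIQUEFREE_k` along the complement map, cut down to code words.
[folklore] -/
theorem indepFreeLangAt_eq (k : ℕ → ℕ) {f : List Bool → List Bool}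
    (hf : ∀ (n : ℕ) (G : SimpleGraph (Fin n)), f (encodingGraph.encode ⟨n, G⟩) = encodingGraph.encode ⟨n, Gᶜ⟩) :
    indepFreeLangAt k = HamNP.gcodeLang ⊓ (f ⁻¹' cliqueFreeLangAt k : Language Bool) := by
  refine Set.ext fun x => ⟨?_, ?_⟩
  · rintro ⟨⟨n, G⟩, hG, rfl⟩
    refine ⟨(HamNP.mem_gcodeLang_iff _).2 ⟨n, G, rfl⟩, ?_⟩
    show f (encodingGraph.encode ⟨n, G⟩) ∈ cliqueFreeLangAt k
    rw [hf]
    exact (Encoding.mem_toLanguage_iff _ _ _).2 hG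
  · rintro ⟨hx, hfx⟩
    obtain ⟨n, G, rfl⟩ := (HamNP.mem_gcodeLang_iff x).1 hx
    have hfx' : f (encodingGraph.encode ⟨n, G⟩) ∈ cliqueFreeLangAt k := hfx
    rw [hf] at hfx'
    have hG := (Encoding.mem_toLanguage_iff _ _ _).1 hfx'
    exact ⟨⟨n, G⟩, hG, rfl⟩

/-- … and symmetrically. [folklore] -/
theorem cliqueFreeLangAt_eq (k : ℕ → ℕ) {f : List Bool → List Bool}
    (hf : ∀ (n : ℕ) (G : SimpleGraph (Fin n)), f (encodingGraph.encode ⟨n, G⟩) = encodingGraph.encode ⟨n, Gᶜ⟩) :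
    cliqueFreeLangAt k = HamNP.gcodeLang ⊓ (f ⁻¹' indepFreeLangAt k : Language Bool) := by
  refine Set.ext fun x => ⟨?_, ?_⟩
  · rintro ⟨⟨n, G⟩, hG, rfl⟩
    refine ⟨(HamNP.mem_gcodeLang_iff _).2 ⟨n, G, rfl⟩, ?_⟩
    show f (encodingGraph.encode ⟨n, G⟩) ∈ indepFreeLangAt k
    rw [hf]
    refine (Encoding.mem_toLanguage_iff _ _ _).2 ?_
    show Gᶜᶜ.CliqueFree (k n)
    rw [compl_compl]
    exact hG
  · rintro ⟨hx, hfx⟩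
    obtain ⟨n, G, rfl⟩ := (HamNP.mem_gcodeLang_iff x).1 hx
    have hfx' : f (encodingGraph.encode ⟨n, G⟩) ∈ indepFreeLangAt k := hfx
    rw [hf] at hfx'
    have hG : Gᶜᶜ.CliqueFree (k n) := (Encoding.mem_toLanguage_iff _ _ _).1 hfx'
    rw [compl_compl] at hG
    exact ⟨⟨n, G⟩, hG, rfl⟩

/-- **Complement symmetry**: `CLIQUEFREE_k ∈ NP ↔ INDEPFREE_k ∈ NP`. [folklore] -/
theorem cliqueFree_mem_NP_iff (k : ℕ → ℕ) :
    cliqueFreeLangAt k ∈ Nondeterministic.NP ↔ indepFreeLangAt k ∈ Nondeterministic.NP := by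
  obtain ⟨f, hf, hspec⟩ := exists_complFn
  constructor
  · intro h
    rw [indepFreeLangAt_eq k hspec]
    exact inter_P_mem_polyExists (K := Classes.P) (fun _ _ a b => inter_mem_P a b) HamNP.gcodeLang_mem_P
      (preimage_mem_NP h hf)
  · intro h
    rw [cliqueFreeLangAt_eq k hspec]
    exact inter_P_mem_polyExists (K := Classes.P) (fun _ _ a b => inter_mem_P a b) HamNP.gcodeLang_mem_P
      (preimage_mem_NP h hf)

/-- **Complement symmetry in `P`**: `CLIQUEFREE_k ∈ P ↔ INDEPFREE_k ∈ P`. [folklore] -/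
theorem cliqueFree_mem_P_iff (k : ℕ → ℕ) :
    cliqueFreeLangAt k ∈ Classes.P ↔ indepFreeLangAt k ∈ Classes.P := by
  obtain ⟨f, hf, hspec⟩ := exists_complFn
  constructor
  · intro h
    rw [indepFreeLangAt_eq k hspec]
    exact inter_mem_P HamNP.gcodeLang_mem_P (preimage_mem_P h hf)
  · intro h
    rw [cliqueFreeLangAt_eq k hspec]
    exact inter_mem_P HamNP.gcodeLang_mem_P (preimage_mem_P h hf)

/-- **The crux forces the one-sided statement**: `RAMSEY_k ∉ NP → CLIQUEFREE_k ∉ NP`. [folklore] -/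
theorem cliqueFree_not_mem_NP_of_ramseyNotNPAt {k : ℕ → ℕ} (h : RamseyNotNPAt k) :
    cliqueFreeLangAt k ∉ Nondeterministic.NP := fun hc =>
  (oneSided_of_ramseyNotNPAt h).elim (fun h' => h' hc) fun h' => h' ((cliqueFree_mem_NP_iff k).1 hc)

/-- … and `RAMSEY_k ∉ NP → INDEPFREE_k ∉ NP`. [folklore] -/
theorem indepFree_not_mem_NP_of_ramseyNotNPAt {k : ℕ → ℕ} (h : RamseyNotNPAt k) :
    indepFreeLangAt k ∉ Nondeterministic.NP := fun hc =>
  cliqueFree_not_mem_NP_of_ramseyNotNPAt h ((cliqueFree_mem_NP_iff k).2 hc)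

/-- `RAMSEY_k ∉ P → CLIQUEFREE_k ∉ P`. [folklore] -/
theorem cliqueFree_not_mem_P_of_ramsey_not_mem_P {k : ℕ → ℕ} (h : ramseyLangAt k ∉ Classes.P) :
    cliqueFreeLangAt k ∉ Classes.P := fun hc => by
  apply h
  rw [ramseyLangAt_eq_inter]
  exact inter_mem_P hc ((cliqueFree_mem_P_iff k).1 hc)

/-! ## §10 The lattice of sufficient targets bottoms out at `CLIQUEFREE_{⌈2log₂n⌉} ∉ P` -/

/-- The threshold numeral is computable on codes: `(n, bits) ↦ ((n, bits), Nat.size (n·n − 1))`, and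
`Nat.size (n·n − 1) = thr n`. [folklore] -/
theorem exists_thrPairFn : ∃ g ∈ FP, ∀ (n : ℕ) (G : SimpleGraph (Fin n)),
    g (encodingGraph.encode ⟨n, G⟩) = boolPair (encodingGraph.encode ⟨n, G⟩) (encodeNat (thr n)) := by
  have hn : CodeFP (CodeFP.pairE CodeFP.natE CodeFP.strE) CodeFP.natE (fun q : ℕ × List Bool => q.1) :=
    CodeFP.fst _ _
  have hsize : CodeFP CodeFP.natE CodeFP.natE Nat.size :=
    (CodeFP.strNatLength.comp CodeFP.strOfNat).congr fun m => CodeFP.length_natE m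
  have hk : CodeFP (CodeFP.pairE CodeFP.natE CodeFP.strE) CodeFP.natE
      (fun q : ℕ × List Bool => Nat.size (q.1 * q.1 - 1)) :=
    hsize.comp (CodeFP.natSub.comp ((CodeFP.natMul.comp (hn.pair hn)).pair (CodeFP.const _ 1)))
  obtain ⟨g, hg, hspec⟩ := (CodeFP.id _).pair hk
  refine ⟨g, hg, fun n G => ?_⟩
  have h := hspec (n, CliqueNP.adjBits n G)
  dsimp only [id] at h
  rw [Summit.PneNP.PneNP.Theorems.RamseyUncertifiableRamseyInCoNP.size_mul_self_pred] at h
  rw [HamNP.encode_eq]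
  exact h

/-- **`CLIQUEFREE_{⌈2log₂n⌉} ∈ coNP`** (the complement is "not a code word, or CLIQUE at `k = thr n`";
`CLIQUE_mem_NP` pulled back along the threshold pairing). [folklore] -/
theorem cliqueFreeLang_thr_mem_coNP : cliqueFreeLangAt thr ∈ coNP := by
  obtain ⟨g, hg, hspec⟩ := exists_thrPairFn
  have heq : (cliqueFreeLangAt thr)ᶜ = HamNP.gcodeLangᶜ ⊔ (HamNP.gcodeLang ⊓ (g ⁻¹' CLIQUE : Language Bool)) := by
    refine Set.ext fun x => ⟨fun hx => ?_, ?_⟩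
    · by_cases hc : x ∈ HamNP.gcodeLang
      · obtain ⟨n, G, rfl⟩ := (HamNP.mem_gcodeLang_iff x).1 hc
        refine Or.inr ⟨hc, ?_⟩
        show g (encodingGraph.encode ⟨n, G⟩) ∈ CLIQUE
        rw [hspec]
        refine ⟨(⟨n, G⟩, thr n), ?_, rfl⟩
        show ¬ G.CliqueFree (thr n)
        intro hG
        exact hx ⟨⟨n, G⟩, hG, rfl⟩
      · exact Or.inl hc
    · rintro (hc | ⟨hc, hgx⟩) hx
      · obtain ⟨⟨n, G⟩, -, rfl⟩ := hx
        exact hc ((HamNP.mem_gcodeLang_iff _).2 ⟨n, G, rfl⟩)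
      · obtain ⟨⟨n, G⟩, hG, rfl⟩ := hx
        have hgx' : g (encodingGraph.encode ⟨n, G⟩) ∈ CLIQUE := hgx
        rw [hspec] at hgx'
        obtain ⟨⟨⟨m, H⟩, k'⟩, hH, he⟩ := hgx'
        have he' : (⟨m, H⟩, k') = ((⟨n, G⟩ : Σ n, SimpleGraph (Fin n)), thr n) :=
          (encodingGraph.pairBool encodingNatBool).encode_injective he
        rw [he'] at hH
        exact hH hG
  show (cliqueFreeLangAt thr)ᶜ ∈ Nondeterministic.NP
  rw [heq]
  exact union_P_mem_polyExists (K := Classes.P) (fun _ _ a b => union_mem_P a b)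
    (compl_mem_P_iff.2 HamNP.gcodeLang_mem_P)
    (inter_P_mem_polyExists (K := Classes.P) (fun _ _ a b => inter_mem_P a b) HamNP.gcodeLang_mem_P
      (preimage_mem_NP CLIQUE_mem_NP hg))

/-- **The bottom of the lattice closes the summit** (stated contrapositively: no summit conclusion in
this file): if the summit fails then `CLIQUEFREE_{⌈2log₂n⌉} ∈ P`; i.e. "no polynomial-time algorithm decides
`ω(G) < ⌈2 log₂ n⌉`" (the classical LOGCLIQUE ∉ P, implied by ETH) already gives the summit. [folklore] -/
theorem cliqueFreeLang_thr_mem_P_of_not_pneNP (hne : ¬ PneNP) : cliqueFreeLangAt thr ∈ Classes.P :=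
  coNP_eq_P_of_not_pneNP hne ▸ cliqueFreeLang_thr_mem_coNP

/-- **The lattice.** `RamseyNotNP` (two-sided, `∉ NP`) ⟹ `CLIQUEFREE_thr ∉ NP` ⟹ `CLIQUEFREE_thr ∉ P`, and
`RamseyNotNP` ⟹ `RAMSEY₂ ∉ P` ⟹ `CLIQUEFREE_thr ∉ P`; and (contrapositively) the bottom node already closes
the summit.  The crux as filed is the TOP of this lattice. [folklore] -/
theorem targetLattice :
    (RamseyNotNP → cliqueFreeLangAt thr ∉ Nondeterministic.NP) ∧
    (cliqueFreeLangAt thr ∉ Nondeterministic.NP → cliqueFreeLangAt thr ∉ Classes.P) ∧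
    (RamseyNotNP → ramseyLangAt thr ∉ Classes.P) ∧
    (ramseyLangAt thr ∉ Classes.P → cliqueFreeLangAt thr ∉ Classes.P) ∧
    (¬ PneNP → cliqueFreeLangAt thr ∈ Classes.P) :=
  ⟨fun hX => cliqueFree_not_mem_NP_of_ramseyNotNPAt (k := thr) hX, fun h hc => h (P_subset_NP_holds hc),
    ramseyNotP_of_ramseyNotNP, fun h => cliqueFree_not_mem_P_of_ramsey_not_mem_P (k := thr) h,
    cliqueFreeLang_thr_mem_P_of_not_pneNP⟩


/-- **A one-sided certificate scheme already refutes the crux**: `CLIQUEFREE_{⌈2log₂n⌉} ∈ NP → ¬ RamseyNotNP`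
(contrapositive of `cliqueFree_not_mem_NP_of_ramseyNotNPAt`). [folklore] -/
theorem not_ramseyNotNP_of_cliqueFree_mem_NP (h : cliqueFreeLangAt thr ∈ Nondeterministic.NP) :
    ¬ RamseyNotNP :=
  fun hX => cliqueFree_not_mem_NP_of_ramseyNotNPAt (k := thr) hX h

/-- **A polynomial-time LOGCLIQUE algorithm already refutes the crux**: `CLIQUEFREE_{⌈2log₂n⌉} ∈ P →
¬ RamseyNotNP`. [folklore] -/
theorem not_ramseyNotNP_of_cliqueFree_mem_P (h : cliqueFreeLangAt thr ∈ Classes.P) : ¬ RamseyNotNP :=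
  not_ramseyNotNP_of_cliqueFree_mem_NP (P_subset_NP_holds h)

end Summit.PneNP.PneNP.Theorems.RamseyNotNP.Negative
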